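import Literature.Probability.Percolation.ConditionalPositiveAssociationProofs
import HarnessLib

/-!
# The law-level shadow of CONJECTURE NO-CORE is a theorem: `Cov(f,g) ≥ P(x↔y)·E[f g; x↔y] − E[f; x↔y]·E[g; x↔y]`

Support file (`--supports stmt-CriticalPhenomena-4575`, closed), prover `prim-lf-2` (gen 46).  No definitions, no named facts, no sorries; standard axioms.
Memo `prim-lf-2/CW-BOX-gen46.md` §0(i)(d).

prim-lf-2 gen 46 found the two-colouring ('coefficientwise') conjecture NO-CORE(y): for the uniform two-colouring of the edges of every multigraph,
`Σ_{s : y ∉ C_x(s) ∩ C_x(sᶜ)} (f(C_x s) − f(C_x sᶜ))(g(C_x s) − g(C_x sᶜ)) ≥ 0` (census: all graphs on ≤ 8 vertices with ≤ 10 edges).  Averaged over minors this is the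
following statement about two INDEPENDENT copies `ω₁, ω₂` of bond percolation with arbitrary edge weights: `E[(f(C¹) − f(C²))(g(C¹) − g(C²)) ; y ∉ C¹ ∩ C²] ≥ 0`
for increasing `f, g` of the open cluster of `x` — equivalently, in ONE copy with `Y = {x ↔ y}`,
  `E[f g] − E[f]·E[g] ≥ P(Y)·E[f g 1_Y] − E[f 1_Y]·E[g 1_Y]`   ( = `P(Y)²·Cov(f, g | Y)` when `P(Y) > 0` ):
conditioning on a connection `x ↔ y` can raise the covariance of two increasing cluster functions by at most the factor `P(x↔y)⁻²`.  Unlike its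
coefficientwise form this IS a theorem, and a short consequence of van den Berg–Häggström–Kahn's Theorem 1.3 (the tree's
`BHK2006_clusterConditionalPositiveAssociation_holds`, here used through the finite-sum engine `BHK2006.core`): conditioned on `A = {y ∉ C¹∩C²}` the law of
`ω₁` is the mixture `(P + P(Y)·P(· | x ↮ y))/(1 + P(Y))` of two positively associated, stochastically ordered laws, hence positively associated (for pairs
of increasing cluster functions), while across the copies `E_A[f(C¹) g(C²)] ≤ E_A[f(C¹)] E_A[g(C²)]` is Harris twice; with `E_A f(C¹) = E_A f(C²)` the two give
the display.  The proof below is the resulting one-line certificate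
  `(1−p)(1+p)·(LHS − RHS) = (1−p)²(1+p)·[Harris] + p(1+p)·[BHK 1.2 on {x ↮ y}] + p·(Harris×Harris) + (Harris×Harris)`.

* `noCore_lawLevel` — the display, in BHK2006's finite-sum form (`Σ_ω weight w ω · …`, `∑ weight = 1`, `F, G ≥ 0` increasing functions of
  `openEdgeCluster ω x`, `Y = {ω | x ↔ y}`), for every finite vertex type and all edge weights in `[0,1]`.
[cite: VandenbergHaggstromKahn2005, Thm. 1.3 (p. 6), Thm. 1.2 (p. 5) (the ingredient); KozmaNitzan2024, Questions 8–9 (§5.5 p. 36) (context)]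
-/

namespace Summit.CriticalPhenomena.PercolationContinuityZ3.Theorems

open Finset Literature.Probability.Percolation Literature.Probability.Percolation.BHK2006
open DecisionTree (ind ind_of_mem ind_of_not_mem ind_nonneg)

namespace Coefficientwise

open Classical in
/-- **Law-level NO-CORE** (prim-lf-2 gen 46; the two-colouring version is CONJECTURE NO-CORE of memo CW-BOX-gen46).  For bond percolation with edge
weights `w ∈ [0,1]` on a finite vertex type (`∑ weight w = 1`), a root `x`, a vertex `y`, `Y = {ω | x ↔ y}` and `F, G ≥ 0` increasing,
`f = F ∘ C_x`, `g = G ∘ C_x` (`C_x = openEdgeCluster · x`):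
  `(Σ w·1_Y)(Σ w·f g 1_Y) − (Σ w·f 1_Y)(Σ w·g 1_Y) ≤ (Σ w·f g) − (Σ w·f)(Σ w·g)`,
i.e. `P(Y)·E[fg;Y] − E[f;Y]E[g;Y] ≤ Cov(f,g)`.  Ingredients: Harris (`BHK2006.harris`) three times and BHK's Theorem 1.2 on `{x ↮ y}` (`BHK2006.core` with
`X = Y = {y}`). [cite: VandenbergHaggstromKahn2005, Thm. 1.2 (p. 5), Thm. 1.3 (p. 6)] -/
theorem noCore_lawLevel {V : Type*} [Fintype V] (w : Sym2 V → ℝ) (hw0 : ∀ e, 0 ≤ w e) (hw1 : ∀ e, w e ≤ 1)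
    (hm : ∑ ω, weight w ω = 1) (x y : V) (F G : Set (Sym2 V) → ℝ) (hF : Monotone F) (hG : Monotone G)
    (hF0 : ∀ a, 0 ≤ F a) (hG0 : ∀ a, 0 ≤ G a) :
    (∑ ω, weight w ω * ind {ω : Set (Sym2 V) | (openGraph ω).Reachable x y} ω) *
        (∑ ω, weight w ω * (F (openEdgeCluster ω x) * G (openEdgeCluster ω x) *
          ind {ω : Set (Sym2 V) | (openGraph ω).Reachable x y} ω)) -
      (∑ ω, weight w ω * (F (openEdgeCluster ω x) * ind {ω : Set (Sym2 V) | (openGraph ω).Reachable x y} ω)) *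
        (∑ ω, weight w ω * (G (openEdgeCluster ω x) * ind {ω : Set (Sym2 V) | (openGraph ω).Reachable x y} ω)) ≤
    (∑ ω, weight w ω * (F (openEdgeCluster ω x) * G (openEdgeCluster ω x))) -
      (∑ ω, weight w ω * F (openEdgeCluster ω x)) * (∑ ω, weight w ω * G (openEdgeCluster ω x)) := by
  -- the case `x = y`: `Y` is everything and both sides coincide
  set Y : Set (Set (Sym2 V)) := {ω | (openGraph ω).Reachable x y} with hY
  set f : Set (Sym2 V) → ℝ := fun ω => F (openEdgeCluster ω x) with hf
  set g : Set (Sym2 V) → ℝ := fun ω => G (openEdgeCluster ω x) with hg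
  change (∑ ω, weight w ω * ind Y ω) * (∑ ω, weight w ω * (f ω * g ω * ind Y ω)) -
      (∑ ω, weight w ω * (f ω * ind Y ω)) * (∑ ω, weight w ω * (g ω * ind Y ω)) ≤
    (∑ ω, weight w ω * (f ω * g ω)) - (∑ ω, weight w ω * f ω) * (∑ ω, weight w ω * g ω)
  -- monotonicity of the ingredients
  have hfm : Monotone f := fun a b hab => hF (openEdgeCluster_mono hab x)
  have hgm : Monotone g := fun a b hab => hG (openEdgeCluster_mono hab x)
  have hf0 : ∀ a, 0 ≤ f a := fun a => hF0 _
  have hg0 : ∀ a, 0 ≤ g a := fun a => hG0 _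
  have hYup : ∀ {a b : Set (Sym2 V)}, a ⊆ b → a ∈ Y → b ∈ Y := fun hab ha => by
    simp only [hY, Set.mem_setOf_eq] at ha ⊢
    exact ha.mono (openGraph_le hab)
  have hIm : Monotone (ind Y) := by
    intro a b hab
    by_cases ha : a ∈ Y
    · rw [ind_of_mem ha, ind_of_mem (hYup hab ha)]
    · rw [ind_of_not_mem ha]; exact ind_nonneg Y b
  have hI0 : ∀ a, 0 ≤ ind Y a := fun a => ind_nonneg Y a
  have hI1 : ∀ a, ind Y a ≤ 1 := fun a => ind_le_one Y a
  have hIsq : ∀ a, ind Y a * ind Y a = ind Y a := fun a => by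
    by_cases ha : a ∈ Y
    · rw [ind_of_mem ha]; norm_num
    · rw [ind_of_not_mem ha]; norm_num
  -- names for the seven sums
  set a := ∑ ω, weight w ω * f ω with ha
  set b := ∑ ω, weight w ω * g ω with hb
  set c := ∑ ω, weight w ω * (f ω * g ω) with hc
  set p := ∑ ω, weight w ω * ind Y ω with hp
  set aY := ∑ ω, weight w ω * (f ω * ind Y ω) with haY
  set bY := ∑ ω, weight w ω * (g ω * ind Y ω) with hbY
  set cY := ∑ ω, weight w ω * (f ω * g ω * ind Y ω) with hcY
  -- (1) Harris for f, g
  have h1 : a * b ≤ c := by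
    have := harris hw0 hw1 hf0 hg0 hfm hgm
    rw [hm, one_mul] at this
    exact this
  -- (2) Harris for f (resp. g) and 1_Y
  have h2a : a * p ≤ aY := by
    have := harris hw0 hw1 hf0 hI0 hfm hIm
    rw [hm, one_mul] at this
    exact this
  have h2b : b * p ≤ bY := by
    have := harris hw0 hw1 hg0 hI0 hgm hIm
    rw [hm, one_mul] at this
    exact this
  -- (3) BHK Theorem 1.2 on `D = {x ↮ y}`: (a − aY)(b − bY) ≤ (c − cY)(1 − p)
  have h3 : (a - aY) * (b - bY) ≤ (c - cY) * (1 - p) := by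
    by_cases hxy : x = y
    · -- `Y` is everything: all four factors vanish
      have hall : ∀ ω : Set (Sym2 V), ω ∈ Y := fun ω => by
        rw [hY, Set.mem_setOf_eq, hxy]
      have e1 : aY = a := Finset.sum_congr rfl fun ω _ => by rw [ind_of_mem (hall ω), mul_one]
      have e2 : bY = b := Finset.sum_congr rfl fun ω _ => by rw [ind_of_mem (hall ω), mul_one]
      have e3 : cY = c := Finset.sum_congr rfl fun ω _ => by rw [ind_of_mem (hall ω), mul_one]
      rw [e1, e2, e3]; simp
    · have hE : ∀ ω : Set (Sym2 V), ω ∩ edgesIn (Finset.univ : Finset V) = ω := fun ω => by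
        ext e
        simp only [Set.mem_inter_iff, edgesIn, Set.mem_setOf_eq, Finset.mem_univ, imp_true_iff, and_true]
      have hC : ∀ ω, rC Finset.univ x ω = openEdgeCluster ω x := fun ω => by simp only [rC, hE]
      have hD : ∀ ω, ind (rD Finset.univ x ({y} : Set V)) ω = 1 - ind Y ω := by
        intro ω
        have hmem : ω ∈ rD Finset.univ x ({y} : Set V) ↔ ω ∉ Y := by
          simp only [rD, hE, hY, Set.mem_setOf_eq, Set.mem_singleton_iff, forall_eq]
        by_cases hω : ω ∈ Y
        · rw [ind_of_mem hω, ind_of_not_mem (fun h => (hmem.mp h) hω)]; norm_num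
        · rw [ind_of_not_mem hω, ind_of_mem (hmem.mpr hω)]; norm_num
      have hyU : ({y} : Set V) ⊆ ↑(Finset.univ : Finset V) := by simp
      have key := core w hw0 hw1 hm Finset.univ x (Finset.mem_univ x) {y} {y} hyU hyU F G hF hG hF0 hG0
      rw [Set.inter_self, Set.union_self] at key
      simp only [hC, hD] at key
      -- rewrite the four sums of `key` in terms of a, aY, b, bY, c, cY, p
      have s1 : ∑ ω, weight w ω * (F (openEdgeCluster ω x) * (1 - ind Y ω)) = a - aY := by
        rw [ha, haY, ← Finset.sum_sub_distrib]
        exact Finset.sum_congr rfl fun ω _ => by simp only [hf]; ring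
      have s2 : ∑ ω, weight w ω * (G (openEdgeCluster ω x) * (1 - ind Y ω)) = b - bY := by
        rw [hb, hbY, ← Finset.sum_sub_distrib]
        exact Finset.sum_congr rfl fun ω _ => by simp only [hg]; ring
      have s3 : ∑ ω, weight w ω * (F (openEdgeCluster ω x) * G (openEdgeCluster ω x) * (1 - ind Y ω)) = c - cY := by
        rw [hc, hcY, ← Finset.sum_sub_distrib]
        exact Finset.sum_congr rfl fun ω _ => by simp only [hf, hg]; ring
      have s4 : ∑ ω, weight w ω * (1 - ind Y ω) = 1 - p := by
        rw [hp]
        have : ∑ ω, weight w ω * (1 - ind Y ω) = ∑ ω, weight w ω - ∑ ω, weight w ω * ind Y ω := by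
          rw [← Finset.sum_sub_distrib]; exact Finset.sum_congr rfl fun ω _ => by ring
        rw [this, hm]
      rw [s1, s2, s3, s4] at key
      exact key
  -- elementary bounds
  have hp0 : 0 ≤ p := Finset.sum_nonneg fun ω _ => mul_nonneg (weight_nonneg hw0 hw1 ω) (hI0 ω)
  have hp1 : p ≤ 1 := by
    have : p ≤ ∑ ω, weight w ω :=
      Finset.sum_le_sum fun ω _ => by
        have := mul_le_mul_of_nonneg_left (hI1 ω) (weight_nonneg hw0 hw1 ω)
        simpa using this
    rw [hm] at this; exact this
  have ha0 : 0 ≤ a := Finset.sum_nonneg fun ω _ => mul_nonneg (weight_nonneg hw0 hw1 ω) (hf0 ω)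
  have hb0 : 0 ≤ b := Finset.sum_nonneg fun ω _ => mul_nonneg (weight_nonneg hw0 hw1 ω) (hg0 ω)
  have haY1 : aY ≤ a := Finset.sum_le_sum fun ω _ => by
    have : f ω * ind Y ω ≤ f ω := by nlinarith [hf0 ω, hI1 ω, hI0 ω]
    exact mul_le_mul_of_nonneg_left this (weight_nonneg hw0 hw1 ω)
  have hbY1 : bY ≤ b := Finset.sum_le_sum fun ω _ => by
    have : g ω * ind Y ω ≤ g ω := by nlinarith [hg0 ω, hI1 ω, hI0 ω]
    exact mul_le_mul_of_nonneg_left this (weight_nonneg hw0 hw1 ω)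
  have hcY1 : cY ≤ c := Finset.sum_le_sum fun ω _ => by
    have : f ω * g ω * ind Y ω ≤ f ω * g ω := by nlinarith [mul_nonneg (hf0 ω) (hg0 ω), hI1 ω, hI0 ω]
    exact mul_le_mul_of_nonneg_left this (weight_nonneg hw0 hw1 ω)
  -- the certificate: (1-p)(1+p)·T = (1-p)²(1+p)(c−ab) + p(1+p)((c−cY)(1−p) − (a−aY)(b−bY)) + p((1−p)a−(a−aY))((1−p)b−(b−bY)) + (aY−pa)(bY−pb)
  have hT : (1 - p) * (1 + p) * ((c - a * b) - (p * cY - aY * bY)) =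
      (1 - p) ^ 2 * (1 + p) * (c - a * b) + p * (1 + p) * ((c - cY) * (1 - p) - (a - aY) * (b - bY)) +
        p * (((1 - p) * a - (a - aY)) * ((1 - p) * b - (b - bY))) + (aY - p * a) * (bY - p * b) := by
    ring
  have hR : 0 ≤ (1 - p) ^ 2 * (1 + p) * (c - a * b) + p * (1 + p) * ((c - cY) * (1 - p) - (a - aY) * (b - bY)) +
        p * (((1 - p) * a - (a - aY)) * ((1 - p) * b - (b - bY))) + (aY - p * a) * (bY - p * b) := by
    have t1 : 0 ≤ (1 - p) ^ 2 * (1 + p) * (c - a * b) :=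
      mul_nonneg (mul_nonneg (sq_nonneg _) (by linarith)) (by linarith)
    have t2 : 0 ≤ p * (1 + p) * ((c - cY) * (1 - p) - (a - aY) * (b - bY)) :=
      mul_nonneg (mul_nonneg hp0 (by linarith)) (by linarith)
    have t3 : 0 ≤ p * (((1 - p) * a - (a - aY)) * ((1 - p) * b - (b - bY))) :=
      mul_nonneg hp0 (mul_nonneg (by linarith) (by linarith))
    have t4 : 0 ≤ (aY - p * a) * (bY - p * b) := mul_nonneg (by linarith) (by linarith)
    linarith
  by_cases hpeq : p = 1
  · -- `Y` has full mass: aY = a, bY = b, cY = c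
    have e1 : aY = a := le_antisymm haY1 (by nlinarith)
    have e2 : bY = b := le_antisymm hbY1 (by nlinarith)
    have e3 : cY = c := by
      -- from h3 with p = 1: (a - aY)(b - bY) ≤ 0 is automatic; use the certificate-free route: cY ≤ c and c − cY ≥ 0 … need equality:
      -- weight of Yᶜ is zero, so every summand of c − cY vanishes
      have hq : ∑ ω, weight w ω * (1 - ind Y ω) = 0 := by
        have : ∑ ω, weight w ω * (1 - ind Y ω) = ∑ ω, weight w ω - ∑ ω, weight w ω * ind Y ω := by
          rw [← Finset.sum_sub_distrib]; exact Finset.sum_congr rfl fun ω _ => by ring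
        rw [this, hm, ← hp, hpeq, sub_self]
      have hzero : ∀ ω, weight w ω * (1 - ind Y ω) = 0 := by
        have hnn : ∀ ω ∈ (Finset.univ : Finset (Set (Sym2 V))), 0 ≤ weight w ω * (1 - ind Y ω) :=
          fun ω _ => mul_nonneg (weight_nonneg hw0 hw1 ω) (by linarith [hI1 ω])
        intro ω
        exact (Finset.sum_eq_zero_iff_of_nonneg hnn).mp hq ω (Finset.mem_univ ω)
      have : c - cY = 0 := by
        rw [hc, hcY, ← Finset.sum_sub_distrib]
        refine Finset.sum_eq_zero fun ω _ => ?_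
        have := hzero ω
        have : weight w ω * (f ω * g ω) - weight w ω * (f ω * g ω * ind Y ω) = (weight w ω * (1 - ind Y ω)) * (f ω * g ω) := by ring
        rw [this, hzero ω, zero_mul]
      linarith
    rw [e1, e2, e3, hpeq, one_mul]
  · have hlt : p < 1 := lt_of_le_of_ne hp1 hpeq
    have hpos : 0 < (1 - p) * (1 + p) := mul_pos (by linarith) (by linarith)
    have : 0 ≤ (1 - p) * (1 + p) * ((c - a * b) - (p * cY - aY * bY)) := by rw [hT]; exact hR
    nlinarith [this, hpos]

end Coefficientwise

end Summit.CriticalPhenomena.PercolationContinuityZ3.Theorems
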